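import Literature.NumberTheory.Rogawski1990.CartanObstruction
import Literature.NumberTheory.GaloisRepresentations.HasseNormEtaleInvolutionFactors
import HarnessLib

/-!
# The obstruction of a regular stable class of `U(H)`, GLOBAL READING: `cartanObsFun p = 0` iff the adelic Cartan class is
# `t⋆ · (y ⊗ 1) · t` with `y` a global `⋆`-symmetric unit of the Cartan algebra (Rogawski 1990, §3.3 Prop. 3.3.1, §3.5 Prop. 3.5.2 (c); Kottwitz 1986 §9)

Topic `NumberTheory/Rogawski1990`; namespace `Literature.NumberTheory.Rogawski1990`; **THEOREMS ONLY** (no definition, no named fact, no instance,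
no notation, no `sorry`).  Cell `pub/hodgecm-mathlib`, ENGINE T1 (crux H413 = `stmt-HodgeConjecture-24833`), row G6, sub-row R6d (B) of
`BLUEPRINT-R6dR7-CartanObsHasse.F0P5a-p03g4` (0a35b92f): the step **P4 = the `hglob` binder of ★ P5 `cartanObsHasse_of_steps`** (`CartanObsHasseOfSteps`
:74–:90), at `obs := MatchingAdeleG₂.cartanObsFun` (★ `CartanObstruction`) and `A := ι → ℤ∕2`.  HC_CM is proved only modulo the printed citations until
rung 0 closes.

THE PRINT.  [Rogawski1990, §3.5 Prop. 3.5.2 (c) p. 29]: the obstruction of the adelic class with Cartan cocycle `x ∈ (𝔸_F ⊗ K)^{τ,×}` vanishes iff `x`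
is a GLOBAL class times a norm, `x = t⋆ · y · t` with `y ∈ K^{τ,×}`, `t ∈ (𝔸_F ⊗ K)ˣ` — coordinate by coordinate on the τ-stable field factors
`K_j` (there the quadratic norm-residue symbol of `K_j ∕ K_j^τ`), the paired factors contributing nothing; [§3.3 Prop. 3.3.1 p. 22] then reads
«global class» as «rational conjugacy class» (Landherr + Hasse, ★ `cartanObsHasse_of_steps`); [Kottwitz1986, §9]: `ker(H¹(F,T) → H¹(𝐀,T))`.

WHAT IS PROVED (CM letters of ★ `CartanObstruction`: `Ψ := adelicCartanGlue (cartanSubalgebra γ₀)`, `τ := cartanInvolutionCM`, `X := adelicCartanRepr p`,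
`x_g := (H ⊗ 1)⁻¹ (H ⊗ 1)_g`).
* `coe_cartanInvolutionCM` (`↑(τ b) = b⋆`), `moduleFinite_cartanSubalgebra`, `isReduced_cartanSubalgebra` (the binders of ★ (D3)),
  `commute_map_adelicCartanGlue` (`Ψ z` commutes with `γ₀ ⊗ 1`), `adelicCartanGlue_map_cartanInvolutionCM` (`Ψ((1 ⊗ τ)z) = (Ψ z)⋆`, (G3)).
* **`forall_isPrincipalNormAt_iff_exists_eq_tmul_mul_mul_map`** — FACTORWISE ⇔ GLOBAL inside the adelic Cartan algebra: for a `τ`-fixed unit `X`,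
  «principal × norm at every τ-stable `𝔪`» iff `X = (1 ⊗ y) · T · (1 ⊗ τ)T` with `y ∈ L[γ₀]ˣ` `τ`-fixed ((→) ★ (D3) `exists_fixed_unit_tmul_mul_mul_map_eq`).
* `exists_global_of_eq_adelicCartanGlue` ∕ `exists_eq_adelicCartanGlue_of_global` — the matrix dictionary through `Ψ` in both directions, for ANY pair
  of adelic conjugators (★ `exists_commute_adelicCartan_eq_of_conj_eq`: `x_{g′} = s⋆ x_g s`; the commutant of the regular `γ₀ ⊗ 1` is commutative,
  ★ `commute_of_commute_map_of_charpoly_separable`).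
* **`MatchingAdeleG₂.cartanObsFun_eq_zero_iff_exists_global`** — THE `hglob` STEP: for every conjugator `g` of `p`,
  `cartanObsFun p = 0 ↔ ∃ y t, Commute y γ₀ ∧ y⋆ = y ∧ IsUnit (det y) ∧ t (γ₀ ⊗ 1) = (γ₀ ⊗ 1) t ∧ x_g = t⋆ · (y ⊗ 1) · t`.

## References
* [Rogawski1990] J. D. Rogawski, *Automorphic Representations of Unitary Groups in Three Variables*, Ann. of Math. Stud. 123 (1990), §3.3 (3.3.1),
  Prop. 3.3.1 p. 22; §3.5 Prop. 3.5.2 (c) p. 29; §5.4 p. 72.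
* [Kottwitz1986] R. E. Kottwitz, *Stable trace formula: elliptic singular terms*, Math. Ann. 275 (1986), §9.
* [CasselsFrohlichANT1967] Cassels–Fröhlich (eds.), *Algebraic Number Theory* (1967), Ch. VII §9.6 (Hasse norm theorem), Ch. II §19 (19.1).
-/

set_option autoImplicit false

noncomputable section

open NumberField IsDedekindDomain Polynomial
open scoped TensorProduct Matrix MatrixGroups


namespace Literature.NumberTheory.Rogawski1990

open Literature.NumberTheory.Automorphic Literature.NumberTheory.GaloisRepresentations Literature.LinearAlgebra.Matrix
open Literature.AlgebraicGeometry.ShimuraVarieties (unitaryGroup mem_unitaryGroup_iff)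

section Global

variable {L : Type} [Field L] [NumberField L] [IsCMField L] {H : Matrix (Fin 3) (Fin 3) L} {γ₀ : (UnitaryGroup.cmDatum L 3 H).Rational}

/-- `↑(τ b) = b⋆` (`hermStar` letters). [cite: Rogawski1990, §3.5 p. 29] -/
theorem coe_cartanInvolutionCM (hH : (H.map (cmConjRingHom L))ᵀ = H) (hHd : IsUnit H.det)
    (hreg : IsRegularElt ((γ₀ : unitaryGroup (cmConjRingHom L) H).val : GL (Fin 3) L)) (b : ↥(cartanSubalgebra γ₀)) :
    ((cartanInvolutionCM hH hHd hreg b : ↥(cartanSubalgebra γ₀)) : Matrix (Fin 3) (Fin 3) L) = hermStar (cmConjRingHom L) H (b : Matrix (Fin 3) (Fin 3) L) :=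
  rfl

/-- `L[γ₀]` is a finite `L⁺`-module. [cite: Rogawski1990, §3.4 p. 27] -/
theorem moduleFinite_cartanSubalgebra (γ₀ : (UnitaryGroup.cmDatum L 3 H).Rational) :
    Module.Finite (↥(maximalRealSubfield L)) ↥(cartanSubalgebra γ₀) :=
  Module.Finite.trans L ↥(cartanSubalgebra γ₀)

/-- `L[γ₀]` is reduced for `γ₀` regular (★ `isReduced_adjoin_singleton`). [cite: Rogawski1990, §3.4 p. 27] -/
theorem isReduced_cartanSubalgebra (hreg : IsRegularElt ((γ₀ : unitaryGroup (cmConjRingHom L) H).val : GL (Fin 3) L)) :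
    IsReduced ↥(cartanSubalgebra γ₀) :=
  isReduced_adjoin_singleton _ hreg

/-- `comap` along `τ` as an algebra HOM is `comap` along `τ` (plumbing between ★ (D3)'s binder and ★ `cartanIndex`). [folklore] -/
private theorem comap_coe_algEquiv {F B : Type} [Field F] [CommRing B] [Algebra F B] (τ : B ≃ₐ[F] B) (I : Ideal B) :
    I.comap (τ : B →ₐ[F] B) = I.comap τ :=
  Ideal.ext fun _ => Iff.rfl

/-- **The factorwise condition, glued (★ (D3)):** for a `τ`-fixed unit `X` of the adelic Cartan algebra, «principal × norm at EVERY τ-stable `𝔪`»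
iff `X = (1 ⊗ y) · T · (1 ⊗ τ) T` GLOBALLY, with `y ∈ L[γ₀]ˣ` `τ`-fixed and `T` an adelic unit — (→) is ★ `exists_fixed_unit_tmul_mul_mul_map_eq`
(the pairs `{𝔪, τ𝔪}` impose nothing), (←) reads the global shape off at each factor. [cite: Rogawski1990, §3.5 Prop. 3.5.2 (c) p. 29] [cite: CasselsFrohlichANT1967, Ch. VII §9.6] -/
theorem forall_isPrincipalNormAt_iff_exists_eq_tmul_mul_mul_map (hH : (H.map (cmConjRingHom L))ᵀ = H) (hHd : IsUnit H.det)
    (hreg : IsRegularElt ((γ₀ : unitaryGroup (cmConjRingHom L) H).val : GL (Fin 3) L)) (X : (adelicCartanAlgebra γ₀)ˣ)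
    (hX : Algebra.TensorProduct.map (AlgHom.id (AdeleRing (𝓞 ↥(maximalRealSubfield L)) ↥(maximalRealSubfield L)) (AdeleRing (𝓞 ↥(maximalRealSubfield L)) ↥(maximalRealSubfield L)))
        (cartanInvolutionCM hH hHd hreg : ↥(cartanSubalgebra γ₀) →ₐ[↥(maximalRealSubfield L)] ↥(cartanSubalgebra γ₀)) (X : adelicCartanAlgebra γ₀) = X) :
    (∀ 𝔪 : cartanIndexCM hH hHd hreg, IsPrincipalNormAt hH hHd hreg (X : adelicCartanAlgebra γ₀) 𝔪.1) ↔
      ∃ (y : (↥(cartanSubalgebra γ₀))ˣ) (T : (adelicCartanAlgebra γ₀)ˣ), cartanInvolutionCM hH hHd hreg (y : ↥(cartanSubalgebra γ₀)) = y ∧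
        (X : adelicCartanAlgebra γ₀) = (1 : AdeleRing (𝓞 ↥(maximalRealSubfield L)) ↥(maximalRealSubfield L)) ⊗ₜ ((y : ↥(cartanSubalgebra γ₀)) : ↥(cartanSubalgebra γ₀)) * (T : adelicCartanAlgebra γ₀) *
          Algebra.TensorProduct.map (AlgHom.id (AdeleRing (𝓞 ↥(maximalRealSubfield L)) ↥(maximalRealSubfield L)) (AdeleRing (𝓞 ↥(maximalRealSubfield L)) ↥(maximalRealSubfield L)))
            (cartanInvolutionCM hH hHd hreg : ↥(cartanSubalgebra γ₀) →ₐ[↥(maximalRealSubfield L)] ↥(cartanSubalgebra γ₀)) (T : adelicCartanAlgebra γ₀) := by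
  classical
  haveI := moduleFinite_cartanSubalgebra γ₀
  haveI := isReduced_cartanSubalgebra hreg
  have hτ : ∀ b, cartanInvolutionCM hH hHd hreg (cartanInvolutionCM hH hHd hreg b) = b :=
    cartanInvolution_cartanInvolution (cmConjRingHom L) (cmConjRingHom_algebraMap L) (IsCMField.complexConj_apply_apply L) hHd hH hreg
      (transpose_map_mul_mul_eq_of_rational γ₀)
  constructor
  · intro h
    obtain ⟨y, hy, T, hT⟩ := exists_fixed_unit_tmul_mul_mul_map_eq (cartanInvolutionCM hH hHd hreg) hτ X hX (fun I hI => by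
      rw [comap_coe_algEquiv] at hI
      exact h ⟨I, hI⟩)
    exact ⟨y, T, hy, hT⟩
  · rintro ⟨y, T, hy, hT⟩ 𝔪
    haveI := 𝔪.1.isMaximal
    refine ⟨(y : ↥(cartanSubalgebra γ₀)), (T : adelicCartanAlgebra γ₀), ((T⁻¹ : (adelicCartanAlgebra γ₀)ˣ) : adelicCartanAlgebra γ₀), ?_, ?_, ?_, ?_⟩
    · exact fun hk => 𝔪.1.isMaximal.ne_top (Ideal.eq_top_of_isUnit_mem _ hk y.isUnit)
    · rw [hy, sub_self]; exact zero_mem _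
    · rw [Units.mul_inv]; exact map_one (Algebra.TensorProduct.map (AlgHom.id (AdeleRing (𝓞 ↥(maximalRealSubfield L)) ↥(maximalRealSubfield L)) (AdeleRing (𝓞 ↥(maximalRealSubfield L)) ↥(maximalRealSubfield L))) (Ideal.Quotient.mkₐ (↥(maximalRealSubfield L)) 𝔪.1.asIdeal)).toRingHom
    · rw [hT]


/-- `Ψ z` commutes with `γ₀ ⊗ 1` (the range of `Ψ` is the commutative adelic Cartan algebra). [cite: Rogawski1990, §3.5 p. 29] -/
theorem commute_map_adelicCartanGlue (z : adelicCartanAlgebra γ₀) :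
    Commute ((((γ₀ : unitaryGroup (cmConjRingHom L) H).val : GL (Fin 3) L) : Matrix (Fin 3) (Fin 3) L).map (algebraMap L (AdeleRing (𝓞 L) L))) (adelicCartanGlue (F := ↥(maximalRealSubfield L)) (cartanSubalgebra γ₀) z) := by
  have hγB : (((γ₀ : unitaryGroup (cmConjRingHom L) H).val : GL (Fin 3) L) : Matrix (Fin 3) (Fin 3) L) ∈ cartanSubalgebra γ₀ := Algebra.self_mem_adjoin_singleton L _
  have hΨγ : adelicCartanGlue (F := ↥(maximalRealSubfield L)) (cartanSubalgebra γ₀) ((1 : AdeleRing (𝓞 ↥(maximalRealSubfield L)) ↥(maximalRealSubfield L)) ⊗ₜ (⟨_, hγB⟩ : ↥(cartanSubalgebra γ₀))) = (((γ₀ : unitaryGroup (cmConjRingHom L) H).val : GL (Fin 3) L) : Matrix (Fin 3) (Fin 3) L).map (algebraMap L (AdeleRing (𝓞 L) L)) :=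
    adelicCartanGlue_one_tmul _ _
  rw [← hΨγ]
  change adelicCartanGlue (F := ↥(maximalRealSubfield L)) (cartanSubalgebra γ₀) _ * adelicCartanGlue (F := ↥(maximalRealSubfield L)) (cartanSubalgebra γ₀) z = adelicCartanGlue (F := ↥(maximalRealSubfield L)) (cartanSubalgebra γ₀) z * adelicCartanGlue (F := ↥(maximalRealSubfield L)) (cartanSubalgebra γ₀) _
  rw [← map_mul, ← map_mul, mul_comm]

/-- `Ψ ((1 ⊗ τ) z) = (Ψ z)⋆` in CM letters ((G3)). [cite: Rogawski1990, §3.5 p. 29] -/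
theorem adelicCartanGlue_map_cartanInvolutionCM (hH : (H.map (cmConjRingHom L))ᵀ = H) (hHd : IsUnit H.det)
    (hreg : IsRegularElt ((γ₀ : unitaryGroup (cmConjRingHom L) H).val : GL (Fin 3) L)) (z : adelicCartanAlgebra γ₀) :
    adelicCartanGlue (F := ↥(maximalRealSubfield L)) (cartanSubalgebra γ₀) (Algebra.TensorProduct.map (AlgHom.id (AdeleRing (𝓞 ↥(maximalRealSubfield L)) ↥(maximalRealSubfield L)) (AdeleRing (𝓞 ↥(maximalRealSubfield L)) ↥(maximalRealSubfield L))) (cartanInvolutionCM hH hHd hreg : ↥(cartanSubalgebra γ₀) →ₐ[↥(maximalRealSubfield L)] ↥(cartanSubalgebra γ₀)) z) = hermStar (adeleConj L) (H.map (algebraMap L (AdeleRing (𝓞 L) L))) (adelicCartanGlue (F := ↥(maximalRealSubfield L)) (cartanSubalgebra γ₀) z) :=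
  adelicCartanGlue_map_eq_hermStar (cartanSubalgebra γ₀) (IsCMField.complexConj L) (cmConjRingHom L) (fun _ => rfl) (adeleConj L)
    (adeleConj_apply L) hHd (cartanInvolutionCM hH hHd hreg) (coe_cartanInvolutionCM hH hHd hreg) z

/-- (→) of the global reading, for ONE conjugator and the shape `Ψ((1 ⊗ y) T (1 ⊗ τ)T)`: then for ANY conjugator `g`, `x_g = t⋆ (y ⊗ 1) t`.
[cite: Rogawski1990, §3.3 (3.3.1) p. 22; §3.5 Prop. 3.5.2 (c) p. 29] -/
theorem exists_global_of_eq_adelicCartanGlue (hH : (H.map (cmConjRingHom L))ᵀ = H) (hHd : IsUnit H.det)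
    (hreg : IsRegularElt ((γ₀ : unitaryGroup (cmConjRingHom L) H).val : GL (Fin 3) L)) (p : MatchingAdeleG₂ L H H γ₀)
    {g₀ g : GL (Fin 3) (AdeleRing (𝓞 L) L)}
    (hg₀ : g₀ * (((UnitaryGroup.cmDatum L 3 H).toAdelic γ₀).val : GL (Fin 3) (AdeleRing (𝓞 L) L)) * g₀⁻¹ = (p.adele.val : GL (Fin 3) (AdeleRing (𝓞 L) L)))
    (hg : g * (((UnitaryGroup.cmDatum L 3 H).toAdelic γ₀).val : GL (Fin 3) (AdeleRing (𝓞 L) L)) * g⁻¹ = (p.adele.val : GL (Fin 3) (AdeleRing (𝓞 L) L)))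
    (y : (↥(cartanSubalgebra γ₀))ˣ) (T : (adelicCartanAlgebra γ₀)ˣ) (hy : cartanInvolutionCM hH hHd hreg (y : ↥(cartanSubalgebra γ₀)) = y)
    (hx₀ : (H.map (algebraMap L (AdeleRing (𝓞 L) L)))⁻¹ * twistGram (adeleConj L) (H.map (algebraMap L (AdeleRing (𝓞 L) L))) (g₀ : Matrix (Fin 3) (Fin 3) (AdeleRing (𝓞 L) L)) =
      adelicCartanGlue (F := ↥(maximalRealSubfield L)) (cartanSubalgebra γ₀) ((1 : AdeleRing (𝓞 ↥(maximalRealSubfield L)) ↥(maximalRealSubfield L)) ⊗ₜ ((y : ↥(cartanSubalgebra γ₀)) : ↥(cartanSubalgebra γ₀)) * (T : adelicCartanAlgebra γ₀) * Algebra.TensorProduct.map (AlgHom.id (AdeleRing (𝓞 ↥(maximalRealSubfield L)) ↥(maximalRealSubfield L)) (AdeleRing (𝓞 ↥(maximalRealSubfield L)) ↥(maximalRealSubfield L))) (cartanInvolutionCM hH hHd hreg : ↥(cartanSubalgebra γ₀) →ₐ[↥(maximalRealSubfield L)] ↥(cartanSubalgebra γ₀)) (T : adelicCartanAlgebra γ₀)))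 :
    ∃ (y : Matrix (Fin 3) (Fin 3) L) (t : GL (Fin 3) (AdeleRing (𝓞 L) L)),
        Commute y (((γ₀ : unitaryGroup (cmConjRingHom L) H).val : GL (Fin 3) L) : Matrix (Fin 3) (Fin 3) L) ∧ hermStar (cmConjRingHom L) H y = y ∧ IsUnit y.det ∧
        t * (((UnitaryGroup.cmDatum L 3 H).toAdelic γ₀).val : GL (Fin 3) (AdeleRing (𝓞 L) L)) = (((UnitaryGroup.cmDatum L 3 H).toAdelic γ₀).val : GL (Fin 3) (AdeleRing (𝓞 L) L)) * t ∧
        (H.map (algebraMap L (AdeleRing (𝓞 L) L)))⁻¹ * twistGram (adeleConj L) (H.map (algebraMap L (AdeleRing (𝓞 L) L))) (g : Matrix (Fin 3) (Fin 3) (AdeleRing (𝓞 L) L)) =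
          hermStar (adeleConj L) (H.map (algebraMap L (AdeleRing (𝓞 L) L))) (t : Matrix (Fin 3) (Fin 3) (AdeleRing (𝓞 L) L)) * y.map (algebraMap L (AdeleRing (𝓞 L) L)) * (t : Matrix (Fin 3) (Fin 3) (AdeleRing (𝓞 L) L)) := by
  classical
  have hregM : (((γ₀ : unitaryGroup (cmConjRingHom L) H).val : GL (Fin 3) L) : Matrix (Fin 3) (Fin 3) L).charpoly.Separable := hreg
  have hγA : ((((UnitaryGroup.cmDatum L 3 H).toAdelic γ₀).val : GL (Fin 3) (AdeleRing (𝓞 L) L)) : Matrix (Fin 3) (Fin 3) (AdeleRing (𝓞 L) L)) = (((γ₀ : unitaryGroup (cmConjRingHom L) H).val : GL (Fin 3) L) : Matrix (Fin 3) (Fin 3) L).map (algebraMap L (AdeleRing (𝓞 L) L)) := rfl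
  have hHAdet : IsUnit (H.map (algebraMap L (AdeleRing (𝓞 L) L))).det := isUnit_det_adelicForm hHd
  have hγAU : ((((((UnitaryGroup.cmDatum L 3 H).toAdelic γ₀).val : GL (Fin 3) (AdeleRing (𝓞 L) L)) : Matrix (Fin 3) (Fin 3) (AdeleRing (𝓞 L) L))).map (adeleConj L))ᵀ * H.map (algebraMap L (AdeleRing (𝓞 L) L)) * ((((UnitaryGroup.cmDatum L 3 H).toAdelic γ₀).val : GL (Fin 3) (AdeleRing (𝓞 L) L)) : Matrix (Fin 3) (Fin 3) (AdeleRing (𝓞 L) L)) = H.map (algebraMap L (AdeleRing (𝓞 L) L)) := toAdelic_val_mem_unitaryGroup γ₀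
  obtain ⟨s, hs, hxs⟩ := exists_commute_adelicCartan_eq_of_conj_eq hHd p hg₀ hg
  -- `x_{g₀} = (y ⊗ 1) · t₀ · t₀⋆`, `t₀ := Ψ T`
  have hΨy : adelicCartanGlue (F := ↥(maximalRealSubfield L)) (cartanSubalgebra γ₀) ((1 : AdeleRing (𝓞 ↥(maximalRealSubfield L)) ↥(maximalRealSubfield L)) ⊗ₜ ((y : ↥(cartanSubalgebra γ₀)) : ↥(cartanSubalgebra γ₀))) =
      ((y : ↥(cartanSubalgebra γ₀)) : Matrix (Fin 3) (Fin 3) L).map (algebraMap L (AdeleRing (𝓞 L) L)) := adelicCartanGlue_one_tmul _ _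
  rw [map_mul, map_mul, hΨy, adelicCartanGlue_map_cartanInvolutionCM hH hHd hreg] at hx₀
  -- units
  have ht₀u : IsUnit (adelicCartanGlue (F := ↥(maximalRealSubfield L)) (cartanSubalgebra γ₀) (T : adelicCartanAlgebra γ₀)) :=
    IsUnit.of_mul_eq_one (adelicCartanGlue (F := ↥(maximalRealSubfield L)) (cartanSubalgebra γ₀) ((T⁻¹ : (adelicCartanAlgebra γ₀)ˣ) : adelicCartanAlgebra γ₀)) (by rw [← map_mul, Units.mul_inv, map_one])
  have ht₀su : IsUnit (hermStar (adeleConj L) (H.map (algebraMap L (AdeleRing (𝓞 L) L))) (adelicCartanGlue (F := ↥(maximalRealSubfield L)) (cartanSubalgebra γ₀) (T : adelicCartanAlgebra γ₀))) := by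
    obtain ⟨t₀', ht₀'⟩ := ht₀u.exists_left_inv
    exact IsUnit.of_mul_eq_one (hermStar (adeleConj L) (H.map (algebraMap L (AdeleRing (𝓞 L) L))) t₀')
      (by rw [← hermStar_mul (adeleConj L) (H.map (algebraMap L (AdeleRing (𝓞 L) L))) hHAdet, ht₀', hermStar_one (adeleConj L) (H.map (algebraMap L (AdeleRing (𝓞 L) L))) hHAdet])
  have htu : IsUnit (hermStar (adeleConj L) (H.map (algebraMap L (AdeleRing (𝓞 L) L))) (adelicCartanGlue (F := ↥(maximalRealSubfield L)) (cartanSubalgebra γ₀) (T : adelicCartanAlgebra γ₀)) * (s : Matrix (Fin 3) (Fin 3) (AdeleRing (𝓞 L) L))) := ht₀su.mul (Units.isUnit s)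
  -- commutation with `γ ⊗ 1`
  have ht₀γ : Commute ((((γ₀ : unitaryGroup (cmConjRingHom L) H).val : GL (Fin 3) L) : Matrix (Fin 3) (Fin 3) L).map (algebraMap L (AdeleRing (𝓞 L) L))) (adelicCartanGlue (F := ↥(maximalRealSubfield L)) (cartanSubalgebra γ₀) (T : adelicCartanAlgebra γ₀)) := commute_map_adelicCartanGlue _
  have hyγ : Commute ((((γ₀ : unitaryGroup (cmConjRingHom L) H).val : GL (Fin 3) L) : Matrix (Fin 3) (Fin 3) L).map (algebraMap L (AdeleRing (𝓞 L) L))) (((y : ↥(cartanSubalgebra γ₀)) : Matrix (Fin 3) (Fin 3) L).map (algebraMap L (AdeleRing (𝓞 L) L))) := by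
    rw [← hΨy]; exact commute_map_adelicCartanGlue _
  have ht₀sγ : Commute ((((γ₀ : unitaryGroup (cmConjRingHom L) H).val : GL (Fin 3) L) : Matrix (Fin 3) (Fin 3) L).map (algebraMap L (AdeleRing (𝓞 L) L))) (hermStar (adeleConj L) (H.map (algebraMap L (AdeleRing (𝓞 L) L))) (adelicCartanGlue (F := ↥(maximalRealSubfield L)) (cartanSubalgebra γ₀) (T : adelicCartanAlgebra γ₀))) := by
    rw [hermStar_def, ← hγA]; exact commute_hermAdjoint_of_commute (adeleConj L) hHAdet hγAU (by rw [hγA]; exact ht₀γ)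
  have hsγ : Commute ((((γ₀ : unitaryGroup (cmConjRingHom L) H).val : GL (Fin 3) L) : Matrix (Fin 3) (Fin 3) L).map (algebraMap L (AdeleRing (𝓞 L) L))) (s : Matrix (Fin 3) (Fin 3) (AdeleRing (𝓞 L) L)) := by
    have := congrArg (fun u : GL (Fin 3) (AdeleRing (𝓞 L) L) => (u : Matrix (Fin 3) (Fin 3) (AdeleRing (𝓞 L) L))) hs
    simp only [Units.val_mul] at this
    rw [← hγA]; exact this.symm
  refine ⟨((y : ↥(cartanSubalgebra γ₀)) : Matrix (Fin 3) (Fin 3) L), htu.unit, commute_of_mem_adjoin_singleton (y : ↥(cartanSubalgebra γ₀)).2,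
    congrArg Subtype.val hy, ?_, ?_, ?_⟩
  · exact Matrix.isUnit_det_of_right_inverse (B := (((y⁻¹ : (↥(cartanSubalgebra γ₀))ˣ) : ↥(cartanSubalgebra γ₀)) : Matrix (Fin 3) (Fin 3) L))
      (by rw [← Subalgebra.coe_mul, ← Units.val_mul, mul_inv_cancel, Units.val_one, Subalgebra.coe_one])
  · apply Units.ext
    rw [Units.val_mul, Units.val_mul, htu.unit_spec, hγA]
    exact ((ht₀sγ.symm).mul_left hsγ.symm).eq
  · rw [htu.unit_spec, hxs, hx₀, hermStar_mul (adeleConj L) (H.map (algebraMap L (AdeleRing (𝓞 L) L))) hHAdet, hermStar_hermStar (adeleConj L) (H.map (algebraMap L (AdeleRing (𝓞 L) L))) hHAdet (adeleConj_adeleConj L) (conjTranspose_adelicForm hH),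
      (commute_of_commute_map_of_charpoly_separable _ hregM hyγ ht₀γ).eq]
    simp only [Matrix.mul_assoc]

/-- (←) of the global reading: from `x_g = t⋆ (y ⊗ 1) t` to the shape `Ψ((1 ⊗ y) T (1 ⊗ τ)T) = x_{g₀}` for any other conjugator `g₀`.
[cite: Rogawski1990, §3.3 (3.3.1) p. 22; §3.5 Prop. 3.5.2 (c) p. 29] -/
theorem exists_eq_adelicCartanGlue_of_global (hH : (H.map (cmConjRingHom L))ᵀ = H) (hHd : IsUnit H.det)
    (hreg : IsRegularElt ((γ₀ : unitaryGroup (cmConjRingHom L) H).val : GL (Fin 3) L)) (p : MatchingAdeleG₂ L H H γ₀)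
    {g₀ g : GL (Fin 3) (AdeleRing (𝓞 L) L)}
    (hg₀ : g₀ * (((UnitaryGroup.cmDatum L 3 H).toAdelic γ₀).val : GL (Fin 3) (AdeleRing (𝓞 L) L)) * g₀⁻¹ = (p.adele.val : GL (Fin 3) (AdeleRing (𝓞 L) L)))
    (hg : g * (((UnitaryGroup.cmDatum L 3 H).toAdelic γ₀).val : GL (Fin 3) (AdeleRing (𝓞 L) L)) * g⁻¹ = (p.adele.val : GL (Fin 3) (AdeleRing (𝓞 L) L)))
    (y : Matrix (Fin 3) (Fin 3) L) (t : GL (Fin 3) (AdeleRing (𝓞 L) L))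
    (hyγ : Commute y (((γ₀ : unitaryGroup (cmConjRingHom L) H).val : GL (Fin 3) L) : Matrix (Fin 3) (Fin 3) L)) (hys : hermStar (cmConjRingHom L) H y = y) (hyu : IsUnit y.det)
    (ht : t * (((UnitaryGroup.cmDatum L 3 H).toAdelic γ₀).val : GL (Fin 3) (AdeleRing (𝓞 L) L)) = (((UnitaryGroup.cmDatum L 3 H).toAdelic γ₀).val : GL (Fin 3) (AdeleRing (𝓞 L) L)) * t)
    (hx : (H.map (algebraMap L (AdeleRing (𝓞 L) L)))⁻¹ * twistGram (adeleConj L) (H.map (algebraMap L (AdeleRing (𝓞 L) L))) (g : Matrix (Fin 3) (Fin 3) (AdeleRing (𝓞 L) L)) =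
      hermStar (adeleConj L) (H.map (algebraMap L (AdeleRing (𝓞 L) L))) (t : Matrix (Fin 3) (Fin 3) (AdeleRing (𝓞 L) L)) * y.map (algebraMap L (AdeleRing (𝓞 L) L)) * (t : Matrix (Fin 3) (Fin 3) (AdeleRing (𝓞 L) L))) :
    ∃ (y : (↥(cartanSubalgebra γ₀))ˣ) (T : (adelicCartanAlgebra γ₀)ˣ), cartanInvolutionCM hH hHd hreg (y : ↥(cartanSubalgebra γ₀)) = y ∧
      adelicCartanGlue (F := ↥(maximalRealSubfield L)) (cartanSubalgebra γ₀) ((1 : AdeleRing (𝓞 ↥(maximalRealSubfield L)) ↥(maximalRealSubfield L)) ⊗ₜ ((y : ↥(cartanSubalgebra γ₀)) : ↥(cartanSubalgebra γ₀)) * (T : adelicCartanAlgebra γ₀) * Algebra.TensorProduct.map (AlgHom.id (AdeleRing (𝓞 ↥(maximalRealSubfield L)) ↥(maximalRealSubfield L)) (AdeleRing (𝓞 ↥(maximalRealSubfield L)) ↥(maximalRealSubfield L))) (cartanInvolutionCM hH hHd hreg : ↥(cartanSubalgebra γ₀) →ₐ[↥(maximalRealSubfield L)] ↥(cartanSubalgebra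 γ₀)) (T : adelicCartanAlgebra γ₀)) =
        (H.map (algebraMap L (AdeleRing (𝓞 L) L)))⁻¹ * twistGram (adeleConj L) (H.map (algebraMap L (AdeleRing (𝓞 L) L))) (g₀ : Matrix (Fin 3) (Fin 3) (AdeleRing (𝓞 L) L)) := by
  classical
  have hregM : (((γ₀ : unitaryGroup (cmConjRingHom L) H).val : GL (Fin 3) L) : Matrix (Fin 3) (Fin 3) L).charpoly.Separable := hreg
  have hγA : ((((UnitaryGroup.cmDatum L 3 H).toAdelic γ₀).val : GL (Fin 3) (AdeleRing (𝓞 L) L)) : Matrix (Fin 3) (Fin 3) (AdeleRing (𝓞 L) L)) = (((γ₀ : unitaryGroup (cmConjRingHom L) H).val : GL (Fin 3) L) : Matrix (Fin 3) (Fin 3) L).map (algebraMap L (AdeleRing (𝓞 L) L)) := rfl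
  have hHAdet : IsUnit (H.map (algebraMap L (AdeleRing (𝓞 L) L))).det := isUnit_det_adelicForm hHd
  have hγAU : ((((((UnitaryGroup.cmDatum L 3 H).toAdelic γ₀).val : GL (Fin 3) (AdeleRing (𝓞 L) L)) : Matrix (Fin 3) (Fin 3) (AdeleRing (𝓞 L) L))).map (adeleConj L))ᵀ * H.map (algebraMap L (AdeleRing (𝓞 L) L)) * ((((UnitaryGroup.cmDatum L 3 H).toAdelic γ₀).val : GL (Fin 3) (AdeleRing (𝓞 L) L)) : Matrix (Fin 3) (Fin 3) (AdeleRing (𝓞 L) L)) = H.map (algebraMap L (AdeleRing (𝓞 L) L)) := toAdelic_val_mem_unitaryGroup γ₀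
  have hγB : (((γ₀ : unitaryGroup (cmConjRingHom L) H).val : GL (Fin 3) L) : Matrix (Fin 3) (Fin 3) L) ∈ cartanSubalgebra γ₀ := Algebra.self_mem_adjoin_singleton L _
  have hinj : Function.Injective (adelicCartanGlue (F := ↥(maximalRealSubfield L)) (cartanSubalgebra γ₀)) := adelicCartanGlue_injective _
  obtain ⟨s, hs, hxs⟩ := exists_commute_adelicCartan_eq_of_conj_eq hHd p hg hg₀
  -- `x_{g₀} = (t s)⋆ (y ⊗ 1) (t s)`
  have hx₀ : (H.map (algebraMap L (AdeleRing (𝓞 L) L)))⁻¹ * twistGram (adeleConj L) (H.map (algebraMap L (AdeleRing (𝓞 L) L))) (g₀ : Matrix (Fin 3) (Fin 3) (AdeleRing (𝓞 L) L)) =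
      hermStar (adeleConj L) (H.map (algebraMap L (AdeleRing (𝓞 L) L))) (((t * s : GL (Fin 3) (AdeleRing (𝓞 L) L)) : Matrix (Fin 3) (Fin 3) (AdeleRing (𝓞 L) L))) * y.map (algebraMap L (AdeleRing (𝓞 L) L)) * (((t * s : GL (Fin 3) (AdeleRing (𝓞 L) L)) : Matrix (Fin 3) (Fin 3) (AdeleRing (𝓞 L) L))) := by
    rw [hxs, hx, Units.val_mul, hermStar_mul (adeleConj L) (H.map (algebraMap L (AdeleRing (𝓞 L) L))) hHAdet]; simp only [Matrix.mul_assoc]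
  -- commutation with `γ ⊗ 1`
  have hts : Commute (t * s) (((UnitaryGroup.cmDatum L 3 H).toAdelic γ₀).val : GL (Fin 3) (AdeleRing (𝓞 L) L)) := by
    change (t * s) * _ = _ * (t * s)
    rw [mul_assoc, hs, ← mul_assoc, ht, mul_assoc]
  have ht₁γ : Commute ((((γ₀ : unitaryGroup (cmConjRingHom L) H).val : GL (Fin 3) L) : Matrix (Fin 3) (Fin 3) L).map (algebraMap L (AdeleRing (𝓞 L) L))) (((t * s : GL (Fin 3) (AdeleRing (𝓞 L) L)) : Matrix (Fin 3) (Fin 3) (AdeleRing (𝓞 L) L))) := by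
    have := congrArg (fun u : GL (Fin 3) (AdeleRing (𝓞 L) L) => (u : Matrix (Fin 3) (Fin 3) (AdeleRing (𝓞 L) L))) hts.eq
    simp only [Units.val_mul] at this
    rw [← hγA]; exact this.symm
  have ht₁'γ : Commute ((((γ₀ : unitaryGroup (cmConjRingHom L) H).val : GL (Fin 3) L) : Matrix (Fin 3) (Fin 3) L).map (algebraMap L (AdeleRing (𝓞 L) L))) ((((t * s)⁻¹ : GL (Fin 3) (AdeleRing (𝓞 L) L)) : Matrix (Fin 3) (Fin 3) (AdeleRing (𝓞 L) L))) := by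
    have := congrArg (fun u : GL (Fin 3) (AdeleRing (𝓞 L) L) => (u : Matrix (Fin 3) (Fin 3) (AdeleRing (𝓞 L) L))) hts.inv_left.eq
    simp only [Units.val_mul] at this
    rw [← hγA]; exact this.symm
  have hyAγ : Commute ((((γ₀ : unitaryGroup (cmConjRingHom L) H).val : GL (Fin 3) L) : Matrix (Fin 3) (Fin 3) L).map (algebraMap L (AdeleRing (𝓞 L) L))) (y.map (algebraMap L (AdeleRing (𝓞 L) L))) := by
    change _ * _ = _ * _
    rw [← Matrix.map_mul, ← hyγ.eq, Matrix.map_mul]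
  have ht₁sγ : Commute ((((γ₀ : unitaryGroup (cmConjRingHom L) H).val : GL (Fin 3) L) : Matrix (Fin 3) (Fin 3) L).map (algebraMap L (AdeleRing (𝓞 L) L))) (hermStar (adeleConj L) (H.map (algebraMap L (AdeleRing (𝓞 L) L))) (((t * s : GL (Fin 3) (AdeleRing (𝓞 L) L)) : Matrix (Fin 3) (Fin 3) (AdeleRing (𝓞 L) L)))) := by
    rw [hermStar_def, ← hγA]; exact commute_hermAdjoint_of_commute (adeleConj L) hHAdet hγAU (by rw [hγA]; exact ht₁γ)
  -- pull back through `Ψ`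
  obtain ⟨T₁, hT₁⟩ := mem_range_adelicCartanGlue_of_commute (F := ↥(maximalRealSubfield L)) (cartanSubalgebra γ₀) hγB hregM ht₁γ
  obtain ⟨T₁', hT₁'⟩ := mem_range_adelicCartanGlue_of_commute (F := ↥(maximalRealSubfield L)) (cartanSubalgebra γ₀) hγB hregM ht₁'γ
  have hTT : T₁ * T₁' = 1 := hinj (by rw [map_mul, hT₁, hT₁', ← Units.val_mul, mul_inv_cancel, Units.val_one, map_one])
  have hTT' : T₁' * T₁ = 1 := by rw [mul_comm]; exact hTT
  -- `y` as a `τ`-fixed unit of `L[γ₀]`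
  have hyB : y ∈ cartanSubalgebra γ₀ := mem_adjoin_singleton_of_commute _ hregM hyγ.symm
  have hyinvγ : Commute y⁻¹ (((γ₀ : unitaryGroup (cmConjRingHom L) H).val : GL (Fin 3) L) : Matrix (Fin 3) (Fin 3) L) := by
    have h1 : y⁻¹ * (((γ₀ : unitaryGroup (cmConjRingHom L) H).val : GL (Fin 3) L) : Matrix (Fin 3) (Fin 3) L) = y⁻¹ * (((γ₀ : unitaryGroup (cmConjRingHom L) H).val : GL (Fin 3) L) : Matrix (Fin 3) (Fin 3) L) * (y * y⁻¹) := by rw [Matrix.mul_nonsing_inv y hyu, Matrix.mul_one]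
    calc y⁻¹ * (((γ₀ : unitaryGroup (cmConjRingHom L) H).val : GL (Fin 3) L) : Matrix (Fin 3) (Fin 3) L) = y⁻¹ * ((((γ₀ : unitaryGroup (cmConjRingHom L) H).val : GL (Fin 3) L) : Matrix (Fin 3) (Fin 3) L) * y) * y⁻¹ := by rw [h1]; simp only [Matrix.mul_assoc]
      _ = y⁻¹ * (y * (((γ₀ : unitaryGroup (cmConjRingHom L) H).val : GL (Fin 3) L) : Matrix (Fin 3) (Fin 3) L)) * y⁻¹ := by rw [hyγ.eq]
      _ = (((γ₀ : unitaryGroup (cmConjRingHom L) H).val : GL (Fin 3) L) : Matrix (Fin 3) (Fin 3) L) * y⁻¹ := by rw [← Matrix.mul_assoc, Matrix.nonsing_inv_mul y hyu, Matrix.one_mul]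
  have hyinvB : y⁻¹ ∈ cartanSubalgebra γ₀ := mem_adjoin_singleton_of_commute _ hregM hyinvγ.symm
  let yU : (↥(cartanSubalgebra γ₀))ˣ :=
    ⟨⟨y, hyB⟩, ⟨y⁻¹, hyinvB⟩, Subtype.ext (Matrix.mul_nonsing_inv y hyu), Subtype.ext (Matrix.nonsing_inv_mul y hyu)⟩
  have hyU : cartanInvolutionCM hH hHd hreg (yU : ↥(cartanSubalgebra γ₀)) = yU := Subtype.ext hys
  have hΨy : adelicCartanGlue (F := ↥(maximalRealSubfield L)) (cartanSubalgebra γ₀) ((1 : AdeleRing (𝓞 ↥(maximalRealSubfield L)) ↥(maximalRealSubfield L)) ⊗ₜ ((yU : ↥(cartanSubalgebra γ₀)) : ↥(cartanSubalgebra γ₀))) = y.map (algebraMap L (AdeleRing (𝓞 L) L)) :=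
    adelicCartanGlue_one_tmul _ _
  refine ⟨yU, ⟨T₁, T₁', hTT, hTT'⟩, hyU, ?_⟩
  rw [map_mul, map_mul, hΨy, adelicCartanGlue_map_cartanInvolutionCM hH hHd hreg, hx₀]
  change y.map (algebraMap L (AdeleRing (𝓞 L) L)) * adelicCartanGlue (F := ↥(maximalRealSubfield L)) (cartanSubalgebra γ₀) T₁ * hermStar (adeleConj L) (H.map (algebraMap L (AdeleRing (𝓞 L) L))) (adelicCartanGlue (F := ↥(maximalRealSubfield L)) (cartanSubalgebra γ₀) T₁) = _
  rw [hT₁, (commute_of_commute_map_of_charpoly_separable _ hregM ht₁sγ hyAγ).eq, Matrix.mul_assoc,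
    ← (commute_of_commute_map_of_charpoly_separable _ hregM ht₁sγ ht₁γ).eq, ← Matrix.mul_assoc]

/-- **THE GLOBAL READING (P4 = ★ P5's `hglob`)**: for every adelic conjugator `g` of the matching adèle `p` (`g (γ₀ ⊗ 1) g⁻¹ = p`), the obstruction
vector `cartanObsFun p` VANISHES iff the adelic Cartan class `x_g = (H ⊗ 1)⁻¹ (H ⊗ 1)_g` is `t⋆ · (y ⊗ 1) · t` with `y ∈ M₃(L)` a GLOBAL `⋆`-symmetric unit
commuting with `γ₀` and `t ∈ GL₃(𝔸_L)` commuting with `γ₀ ⊗ 1` — EXACTLY the `hglob` binder of ★ `cartanObsHasse_of_steps` at `obs := cartanObsFun`,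
`A := ι → ℤ∕2`.  Factorwise (→) is ★ (D3) (`forall_isPrincipalNormAt_iff_exists_eq_tmul_mul_mul_map`), then `Ψ` turns `(1 ⊗ y) T (1 ⊗ τ)T` into
`(y ⊗ 1) · ΨT · (ΨT)⋆ = (ΨT)⋆ (y ⊗ 1) ΨT` (the commutant of the regular `γ₀ ⊗ 1` is commutative) and another conjugator only replaces `t` by `t·s`
(★ `exists_commute_adelicCartan_eq_of_conj_eq`); (←) pulls `t` back through `Ψ` ((G2)). [cite: Rogawski1990, §3.3 (3.3.1), Prop. 3.3.1 p. 22; §3.5 Prop. 3.5.2 (c) p. 29]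
[cite: Kottwitz1986, §9] -/
theorem MatchingAdeleG₂.cartanObsFun_eq_zero_iff_exists_global (hH : (H.map (cmConjRingHom L))ᵀ = H) (hHd : IsUnit H.det)
    (hreg : IsRegularElt ((γ₀ : unitaryGroup (cmConjRingHom L) H).val : GL (Fin 3) L)) (p : MatchingAdeleG₂ L H H γ₀)
    (g : GL (Fin 3) (AdeleRing (𝓞 L) L))
    (hg : g * (((UnitaryGroup.cmDatum L 3 H).toAdelic γ₀).val : GL (Fin 3) (AdeleRing (𝓞 L) L)) * g⁻¹ = (p.adele.val : GL (Fin 3) (AdeleRing (𝓞 L) L))) :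
    p.cartanObsFun hH hHd hreg = 0 ↔
      ∃ (y : Matrix (Fin 3) (Fin 3) L) (t : GL (Fin 3) (AdeleRing (𝓞 L) L)),
        Commute y (((γ₀ : unitaryGroup (cmConjRingHom L) H).val : GL (Fin 3) L) : Matrix (Fin 3) (Fin 3) L) ∧ hermStar (cmConjRingHom L) H y = y ∧ IsUnit y.det ∧
        t * (((UnitaryGroup.cmDatum L 3 H).toAdelic γ₀).val : GL (Fin 3) (AdeleRing (𝓞 L) L)) = (((UnitaryGroup.cmDatum L 3 H).toAdelic γ₀).val : GL (Fin 3) (AdeleRing (𝓞 L) L)) * t ∧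
        (H.map (algebraMap L (AdeleRing (𝓞 L) L)))⁻¹ * twistGram (adeleConj L) (H.map (algebraMap L (AdeleRing (𝓞 L) L))) (g : Matrix (Fin 3) (Fin 3) (AdeleRing (𝓞 L) L)) =
          hermStar (adeleConj L) (H.map (algebraMap L (AdeleRing (𝓞 L) L))) (t : Matrix (Fin 3) (Fin 3) (AdeleRing (𝓞 L) L)) * y.map (algebraMap L (AdeleRing (𝓞 L) L)) * (t : Matrix (Fin 3) (Fin 3) (AdeleRing (𝓞 L) L)) := by
  have hinj : Function.Injective (adelicCartanGlue (F := ↥(maximalRealSubfield L)) (cartanSubalgebra γ₀)) := adelicCartanGlue_injective _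
  rw [p.cartanObsFun_eq_zero_iff_forall hH hHd hreg,
    forall_isPrincipalNormAt_iff_exists_eq_tmul_mul_mul_map hH hHd hreg _ (p.map_cartanInvolutionCM_adelicCartanRepr hH hHd hreg)]
  constructor
  · rintro ⟨y, T, hy, hT⟩
    exact exists_global_of_eq_adelicCartanGlue hH hHd hreg p (p.adelicConjugator_conj hreg) hg y T hy
      (by rw [← hT]; exact (p.adelicCartanGlue_adelicCartanRepr hH hHd hreg).symm)
  · rintro ⟨y, t, hyγ, hys, hyu, ht, hx⟩
    obtain ⟨yU, T, hyU, hΨ⟩ := exists_eq_adelicCartanGlue_of_global hH hHd hreg p (p.adelicConjugator_conj hreg) hg y t hyγ hys hyu ht hx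
    exact ⟨yU, T, hyU, hinj (by rw [hΨ]; exact p.adelicCartanGlue_adelicCartanRepr hH hHd hreg)⟩

end Global

end Literature.NumberTheory.Rogawski1990

end
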